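import Literature.NumberTheory.Transcendental.LinGroupDerivations
import Literature.NumberTheory.Transcendental.IntPolyBounds
import Literature.NumberTheory.Transcendental.DirectionalJets
import HarnessLib

/-!
# Jets of the auxiliary polynomials on `𝔾ₐ^{d₀} × 𝔾ₘ^{d₁}` along invariant derivations: integrality

Topic `Literature/NumberTheory/Transcendental`. Everything here is PROVED (definitions with
bodies, no named facts). Arithmetic half of the auxiliary function of [Waldschmidt1988, §6
Prop. 6.1] for the linear group (hypothesis `hAF` of
`LinGroup.weakObstruction_of_zeroEstimate_of_auxiliary`, `LinearSubgroupTheoremAssembly.lean`):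
the numbers to be killed by Liouville's inequality are the mixed jets
`(D_{u₀} ⋯ D_{u_{k−1}} P)(exp_G y_h)` of the auxiliary polynomial `P = ∑_λ p_λ X^{a_λ} Y^{b_λ}`
(`LinGroup.auxP`) along letters `uᵢ` from an algebraic basis of `W`, at the algebraic points
`exp_G(y_h)`. We show that `k!` times such a jet is the value of an INTEGER polynomial in the
algebraic data with explicit degree and length (`IntPolyBound`, `IntPolyBounds.lean`), without ever
writing that polynomial down:

* `invDeriv_monomial` — `D_x(c X^s) = ∑ᵢ x₀ᵢ s(Xᵢ) c X^{s−eᵢ} + (∑ₗ x₁ₗ s(Yₗ)) c X^s`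
  (`LinGroup.invDeriv`, `LinGroupDerivations.lean`); linearity of the iterates `D_x^k`;
* `jetVal x g k s = (D_x^k X^s)(g)` with the recursion `jetVal_succ`, and
  **`intPolyBound_jetVal`** (induction on `k`): if the coordinates of `g` and of `x` are
  integer-polynomial values then so is `jetVal`, with degree `A e_y + B e_Y + k` and length
  `(L_x (A+B))^k L_y^A L_Y^B` for exponents of `X`-weight `≤ A`, `Y`-weight `≤ B`;
* `auxP p` (`expnt`, `coeff_auxP_expnt`, `auxP_ne_zero`, `degX_auxP_le`, `degY_auxP_le`,
  `evalAt_iterate_auxP`), `intPolyBound_evalAt_iterate_auxP` — line jets of `P_p`;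
* **`factorial_smul_evalAt_wordDeriv`** — `k! (wordDeriv u P)(g exp_G v) = ∑_{S⊆[k]} (−1)^{|Sᶜ|}
  (D_{x_S}^k P)(g exp_G v)`, `x_S = ∑_{i∈S} uᵢ` (polarization of `D^k f(v)`,
  `f(w) = P(g exp_G w)`, through `iteratedFDeriv_evalAt_mul_exp_apply` /
  `iteratedDeriv_evalAt_mul_exp_line`), whence **`intPolyBound_factorial_mul_wordDeriv_auxP`**;
* `vanishesToOrder_of_span_words` — to vanish to order `N` along `exp_G(W)` it suffices that the
  words with letters from a family spanning `W` kill `P` (multilinearity of the jets).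

## References

* [Waldschmidt1988] M. Waldschmidt, *On the transcendence methods of Gel'fond and Schneider in
  several variables*, New Advances in Transcendence Theory (A. Baker ed.), CUP 1988, §6
  Proposition 6.1 (p. 389: "The estimates for the derivatives are provided by Lemma 7 of
  D. Bertrand in Appendix 1 of [14]").
* Yu. V. Nesterenko, P. Philippon (eds.), *Introduction to Algebraic Independence Theory*,
  LNM 1752, Springer 2001, Ch. 11 (D. Roy), §3 (invariant derivations). [NesterenkoPhilippon2001]
-/

noncomputable section

open MvPolynomial Finset
open scoped ContDiff

namespace Literature.NumberTheory.Transcendental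

namespace LinGroup

variable {d₀ d₁ : ℕ}

/-! ### Invariant derivations on monomials -/

/-- `Yₗ ∂/∂Yₗ (c X^s) = s(Yₗ) · c X^s`. [folklore] -/
theorem X_mul_pderiv_inr_monomial (l : Fin d₁) (s : (Fin d₀ ⊕ Fin d₁) →₀ ℕ) (c : ℂ) :
    (X (Sum.inr l) : MvPolynomial (Fin d₀ ⊕ Fin d₁) ℂ) * pderiv (Sum.inr l) (monomial s c) =
      ((s (Sum.inr l) : ℕ) : ℂ) • monomial s c := by
  classical
  rw [pderiv_monomial]
  by_cases h0 : s (Sum.inr l) = 0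
  · rw [h0]; simp
  · have hs : Finsupp.single (Sum.inr l) 1 + (s - Finsupp.single (Sum.inr l) 1) = s := by
      ext v
      simp only [Finsupp.coe_add, Finsupp.coe_tsub, Pi.add_apply, Pi.sub_apply,
        Finsupp.single_apply]
      by_cases hv : Sum.inr l = v
      · subst hv; simp only [if_true]; omega
      · simp [hv]
    rw [X, monomial_mul, hs, one_mul, smul_monomial, smul_eq_mul, mul_comm]

/-- `∂/∂Xᵢ (c X^s) = s(Xᵢ) · c X^{s − eᵢ}`. [folklore] -/
theorem pderiv_inl_monomial (i : Fin d₀) (s : (Fin d₀ ⊕ Fin d₁) →₀ ℕ) (c : ℂ) :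
    pderiv (Sum.inl i) (monomial s c : MvPolynomial (Fin d₀ ⊕ Fin d₁) ℂ) =
      ((s (Sum.inl i) : ℕ) : ℂ) • monomial (s - Finsupp.single (Sum.inl i) 1) c := by
  rw [pderiv_monomial, smul_monomial, smul_eq_mul, mul_comm]

/-- **`D_x` on a monomial**:
`D_x(c X^s) = ∑ᵢ x₀ᵢ s(Xᵢ) · c X^{s−eᵢ} + (∑ₗ x₁ₗ s(Yₗ)) · c X^s`. [folklore] -/
theorem invDeriv_monomial (x : (Fin d₀ → ℂ) × (Fin d₁ → ℂ)) (s : (Fin d₀ ⊕ Fin d₁) →₀ ℕ) (c : ℂ) :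
    invDeriv x (monomial s c) =
      ∑ i : Fin d₀, (x.1 i * s (Sum.inl i)) • monomial (s - Finsupp.single (Sum.inl i) 1) c +
        (∑ l : Fin d₁, x.2 l * s (Sum.inr l)) • monomial s c := by
  rw [invDeriv_apply, Finset.sum_smul]
  congr 1
  · refine Finset.sum_congr rfl fun i _ => ?_
    rw [pderiv_inl_monomial, smul_smul]
  · refine Finset.sum_congr rfl fun l _ => ?_
    rw [X_mul_pderiv_inr_monomial, smul_smul]

/-- Iterates of `D_x` are additive. [folklore] -/
theorem invDeriv_iterate_add (x : (Fin d₀ → ℂ) × (Fin d₁ → ℂ)) (k : ℕ)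
    (P Q : MvPolynomial (Fin d₀ ⊕ Fin d₁) ℂ) :
    (invDeriv x)^[k] (P + Q) = (invDeriv x)^[k] P + (invDeriv x)^[k] Q := by
  induction k generalizing P Q with
  | zero => rfl
  | succ k ih => rw [Function.iterate_succ_apply, Function.iterate_succ_apply,
      Function.iterate_succ_apply, map_add, ih]

/-- Iterates of `D_x` are homogeneous. [folklore] -/
theorem invDeriv_iterate_smul (x : (Fin d₀ → ℂ) × (Fin d₁ → ℂ)) (k : ℕ) (c : ℂ)
    (P : MvPolynomial (Fin d₀ ⊕ Fin d₁) ℂ) :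
    (invDeriv x)^[k] (c • P) = c • (invDeriv x)^[k] P := by
  induction k generalizing P with
  | zero => rfl
  | succ k ih => rw [Function.iterate_succ_apply, Function.iterate_succ_apply, Derivation.map_smul, ih]

/-- Iterates of `D_x` on finite sums. [folklore] -/
theorem invDeriv_iterate_sum (x : (Fin d₀ → ℂ) × (Fin d₁ → ℂ)) (k : ℕ) {κ : Type*} (t : Finset κ)
    (P : κ → MvPolynomial (Fin d₀ ⊕ Fin d₁) ℂ) :
    (invDeriv x)^[k] (∑ j ∈ t, P j) = ∑ j ∈ t, (invDeriv x)^[k] (P j) := by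
  classical
  induction t using Finset.induction_on with
  | empty =>
    rw [Finset.sum_empty, Finset.sum_empty]
    induction k with
    | zero => rfl
    | succ k ih => rw [Function.iterate_succ_apply, map_zero]; exact ih
  | insert a t ha ih => rw [Finset.sum_insert ha, Finset.sum_insert ha, invDeriv_iterate_add, ih]

/-- The values of the iterated jets of monomials: `val_k(s) = (D_x^k X^s)(g)`. [folklore] -/
def jetVal (x : (Fin d₀ → ℂ) × (Fin d₁ → ℂ)) (g : LinGroup d₀ d₁) (k : ℕ)
    (s : (Fin d₀ ⊕ Fin d₁) →₀ ℕ) : ℂ :=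
  evalAt ((invDeriv x)^[k] (monomial s 1)) g

/-- `val_0(s) = ∏ᵥ (coord g v)^{s v}`. [folklore] -/
theorem jetVal_zero (x : (Fin d₀ → ℂ) × (Fin d₁ → ℂ)) (g : LinGroup d₀ d₁)
    (s : (Fin d₀ ⊕ Fin d₁) →₀ ℕ) : jetVal x g 0 s = ∏ v, coord g v ^ s v := by
  classical
  rw [jetVal, Function.iterate_zero_apply, evalAt, eval_monomial, one_mul, Finsupp.prod_fintype]
  simp

/-- **The recursion of the jets**: `val_{k+1}(s) = ∑ᵢ x₀ᵢ s(Xᵢ) val_k(s − eᵢ) + (∑ₗ x₁ₗ s(Yₗ)) val_k(s)`.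
[folklore] -/
theorem jetVal_succ (x : (Fin d₀ → ℂ) × (Fin d₁ → ℂ)) (g : LinGroup d₀ d₁) (k : ℕ)
    (s : (Fin d₀ ⊕ Fin d₁) →₀ ℕ) :
    jetVal x g (k + 1) s = ∑ i : Fin d₀, (x.1 i * s (Sum.inl i)) *
        jetVal x g k (s - Finsupp.single (Sum.inl i) 1) +
      (∑ l : Fin d₁, x.2 l * s (Sum.inr l)) * jetVal x g k s := by
  rw [jetVal, Function.iterate_succ_apply, invDeriv_monomial, invDeriv_iterate_add,
    invDeriv_iterate_sum, invDeriv_iterate_smul, evalAt, map_add, map_sum, smul_eval]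
  congr 1
  refine Finset.sum_congr rfl fun i _ => ?_
  rw [invDeriv_iterate_smul, smul_eval]
  rfl

/-! ### The arithmetic of the jets -/

section Arith

variable {ι : Type*} {a : ι → ℂ}

/-- **Integrality and size of the jets of monomials.** If the coordinates of the point `g` are
`IntPolyBound a _ e_y L_y` (additive ones) and `IntPolyBound a _ e_Y L_Y` (multiplicative ones),
and the coordinates of the direction `x` are `IntPolyBound a _ 1 L_x` (`L_y, L_Y, L_x ≥ 1`), then
for every exponent `s` with `∑ᵢ s(Xᵢ) ≤ A`, `∑ₗ s(Yₗ) ≤ B`: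
`val_k(s) = (D_x^k X^s)(g)` is `IntPolyBound a _ (A e_y + B e_Y + k) ((L_x (A+B))^k L_y^A L_Y^B)`.
[folklore] -/
theorem intPolyBound_jetVal {x : (Fin d₀ → ℂ) × (Fin d₁ → ℂ)} {g : LinGroup d₀ d₁}
    {e_y e_Y : ℕ} {L_y L_Y L_x : ℝ} (hL_y : 1 ≤ L_y) (hL_Y : 1 ≤ L_Y) (hL_x : 1 ≤ L_x)
    (hg₀ : ∀ i, IntPolyBound a (coord g (Sum.inl i)) e_y L_y)
    (hg₁ : ∀ l, IntPolyBound a (coord g (Sum.inr l)) e_Y L_Y)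
    (hx₀ : ∀ i, IntPolyBound a (x.1 i) 1 L_x) (hx₁ : ∀ l, IntPolyBound a (x.2 l) 1 L_x)
    (A B : ℕ) (k : ℕ) :
    ∀ s : (Fin d₀ ⊕ Fin d₁) →₀ ℕ, ∑ i, s (Sum.inl i) ≤ A → ∑ l, s (Sum.inr l) ≤ B →
      IntPolyBound a (jetVal x g k s) (A * e_y + B * e_Y + k)
        ((L_x * (A + B)) ^ k * (L_y ^ A * L_Y ^ B)) := by
  induction k with
  | zero =>
    intro s hA hB
    rw [jetVal_zero, pow_zero, one_mul, add_zero]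
    -- `∏ᵥ (coord g v)^{s v}` : split the product over `inl`/`inr`
    rw [Fintype.prod_sum_type]
    have h0 : IntPolyBound a (∏ i, coord g (Sum.inl i) ^ s (Sum.inl i)) (A * e_y) (L_y ^ A) := by
      have h := IntPolyBound.prod (a := a) Finset.univ
        (x := fun i => coord g (Sum.inl i) ^ s (Sum.inl i))
        (e := fun i => s (Sum.inl i) * e_y) (L := fun i => L_y ^ s (Sum.inl i))
        fun i _ => (hg₀ i).pow _
      refine h.mono ?_ ?_
      · rw [← Finset.sum_mul]; exact Nat.mul_le_mul_right _ hA
      · rw [Finset.prod_pow_eq_pow_sum]; exact pow_le_pow_right₀ hL_y hA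
    have h1 : IntPolyBound a (∏ l, coord g (Sum.inr l) ^ s (Sum.inr l)) (B * e_Y) (L_Y ^ B) := by
      have h := IntPolyBound.prod (a := a) Finset.univ
        (x := fun l => coord g (Sum.inr l) ^ s (Sum.inr l))
        (e := fun l => s (Sum.inr l) * e_Y) (L := fun l => L_Y ^ s (Sum.inr l))
        fun l _ => (hg₁ l).pow _
      refine h.mono ?_ ?_
      · rw [← Finset.sum_mul]; exact Nat.mul_le_mul_right _ hB
      · rw [Finset.prod_pow_eq_pow_sum]; exact pow_le_pow_right₀ hL_Y hB
    exact h0.mul h1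
  | succ k ih =>
    intro s hA hB
    rw [jetVal_succ]
    have hLAB : 0 ≤ L_x * (A + B) := by positivity
    have hK : 0 ≤ (L_x * (A + B)) ^ k * (L_y ^ A * L_Y ^ B) := by positivity
    -- the additive terms
    have hadd : IntPolyBound a (∑ i : Fin d₀, (x.1 i * s (Sum.inl i)) *
        jetVal x g k (s - Finsupp.single (Sum.inl i) 1)) (A * e_y + B * e_Y + (k + 1))
        (∑ i : Fin d₀, L_x * s (Sum.inl i) * ((L_x * (A + B)) ^ k * (L_y ^ A * L_Y ^ B))) := by
      refine IntPolyBound.sum _ fun i _ => ?_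
      have hs' : ∑ i', ((s - Finsupp.single (Sum.inl i) 1 : (Fin d₀ ⊕ Fin d₁) →₀ ℕ)
          (Sum.inl i')) ≤ A :=
        le_trans (Finset.sum_le_sum fun i' _ => by
          simp only [Finsupp.coe_tsub, Pi.sub_apply]; exact Nat.sub_le _ _) hA
      have hB' : ∑ l, ((s - Finsupp.single (Sum.inl i) 1 : (Fin d₀ ⊕ Fin d₁) →₀ ℕ)
          (Sum.inr l)) ≤ B := by
        refine le_trans (le_of_eq (Finset.sum_congr rfl fun l _ => ?_)) hB
        simp
      have h1 := (hx₀ i).mul (IntPolyBound.natCast (a := a) (s (Sum.inl i)))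
      have h2 := h1.mul (ih _ hs' hB')
      refine h2.mono (by omega) (le_of_eq ?_)
      ring
    have hmul : IntPolyBound a ((∑ l : Fin d₁, x.2 l * s (Sum.inr l)) * jetVal x g k s)
        (A * e_y + B * e_Y + (k + 1))
        ((∑ l : Fin d₁, L_x * s (Sum.inr l)) * ((L_x * (A + B)) ^ k * (L_y ^ A * L_Y ^ B))) := by
      have h1 : IntPolyBound a (∑ l : Fin d₁, x.2 l * s (Sum.inr l)) 1
          (∑ l : Fin d₁, L_x * s (Sum.inr l)) := by
        refine IntPolyBound.sum _ fun l _ => ?_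
        have := (hx₁ l).mul (IntPolyBound.natCast (a := a) (s (Sum.inr l)))
        simpa using this
      exact (h1.mul (ih s hA hB)).mono (by omega) le_rfl
    refine (hadd.add hmul).mono (by omega) ?_
    -- `∑ᵢ L_x sᵢ K + (∑ₗ L_x sₗ) K ≤ (L_x (A+B))^{k+1} L_y^A L_Y^B`
    have hA' : (∑ i : Fin d₀, (s (Sum.inl i) : ℝ)) ≤ A := by exact_mod_cast hA
    have hB'' : (∑ l : Fin d₁, (s (Sum.inr l) : ℝ)) ≤ B := by exact_mod_cast hB
    have e1 : ∑ i : Fin d₀, L_x * s (Sum.inl i) * ((L_x * (A + B)) ^ k * (L_y ^ A * L_Y ^ B)) =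
        L_x * (∑ i : Fin d₀, (s (Sum.inl i) : ℝ)) * ((L_x * (A + B)) ^ k * (L_y ^ A * L_Y ^ B)) := by
      rw [Finset.mul_sum, Finset.sum_mul]
    have e2 : (∑ l : Fin d₁, L_x * (s (Sum.inr l) : ℝ)) = L_x * ∑ l : Fin d₁, (s (Sum.inr l) : ℝ) := by
      rw [Finset.mul_sum]
    rw [e1, e2, pow_succ]
    have hLx0 : 0 ≤ L_x := by linarith
    nlinarith [mul_nonneg hLx0 hK, mul_nonneg (mul_nonneg hLx0 hK) (sub_nonneg.2 hA'),
      mul_nonneg (mul_nonneg hLx0 hK) (sub_nonneg.2 hB'')]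

end Arith

/-! ### The auxiliary polynomials `P = ∑_λ p_λ X^{a_λ} Y^{b_λ}` -/

section AuxP

variable {E₀ E₁ : ℕ}

/-- The exponent of the monomial attached to `λ = (a, b)`, `0 ≤ aᵢ < E₀`, `0 ≤ bₗ < E₁`. [folklore] -/
def expnt (lam : (Fin d₀ → Fin E₀) × (Fin d₁ → Fin E₁)) : (Fin d₀ ⊕ Fin d₁) →₀ ℕ :=
  Finsupp.equivFunOnFinite.symm (Sum.elim (fun i => (lam.1 i : ℕ)) (fun l => (lam.2 l : ℕ)))

/-- Additive exponents. [folklore] -/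
@[simp] theorem expnt_inl (lam : (Fin d₀ → Fin E₀) × (Fin d₁ → Fin E₁)) (i : Fin d₀) :
    expnt lam (Sum.inl i) = (lam.1 i : ℕ) := rfl

/-- Multiplicative exponents. [folklore] -/
@[simp] theorem expnt_inr (lam : (Fin d₀ → Fin E₀) × (Fin d₁ → Fin E₁)) (l : Fin d₁) :
    expnt lam (Sum.inr l) = (lam.2 l : ℕ) := rfl

/-- `λ ↦ X^{a_λ} Y^{b_λ}` is injective. [folklore] -/
theorem expnt_injective :
    Function.Injective (expnt (d₀ := d₀) (d₁ := d₁) (E₀ := E₀) (E₁ := E₁)) := by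
  intro lam lam' h
  refine Prod.ext (funext fun i => Fin.ext ?_) (funext fun l => Fin.ext ?_)
  · have := congrArg (fun s => s (Sum.inl i)) h
    simpa using this
  · have := congrArg (fun s => s (Sum.inr l)) h
    simpa using this

/-- **The auxiliary polynomials** `P_p = ∑_λ p_λ X^{a_λ} Y^{b_λ}` with integer coefficients
`p : Λ → ℤ`, `Λ = [0, E₀)^{d₀} × [0, E₁)^{d₁}`. [cite: Waldschmidt1988, §6 Proposition 6.1 (p. 389)] -/
def auxP (p : (Fin d₀ → Fin E₀) × (Fin d₁ → Fin E₁) → ℤ) : MvPolynomial (Fin d₀ ⊕ Fin d₁) ℂ :=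
  ∑ lam, (p lam : ℂ) • monomial (expnt lam) 1

/-- The coefficients of `P_p` are the `p_λ`. [folklore] -/
theorem coeff_auxP_expnt (p : (Fin d₀ → Fin E₀) × (Fin d₁ → Fin E₁) → ℤ)
    (lam : (Fin d₀ → Fin E₀) × (Fin d₁ → Fin E₁)) : (auxP p).coeff (expnt lam) = p lam := by
  classical
  rw [auxP, coeff_sum, Finset.sum_eq_single lam]
  · rw [coeff_smul, coeff_monomial, if_pos rfl, smul_eq_mul, mul_one]
  · intro lam' _ hne
    rw [coeff_smul, coeff_monomial, if_neg (fun h => hne (expnt_injective h)), smul_zero]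
  · intro h; exact absurd (Finset.mem_univ lam) h

/-- The support of `P_p` consists of exponents `expnt λ`. [folklore] -/
theorem exists_of_mem_support_auxP {p : (Fin d₀ → Fin E₀) × (Fin d₁ → Fin E₁) → ℤ}
    {s : (Fin d₀ ⊕ Fin d₁) →₀ ℕ} (hs : s ∈ (auxP p).support) :
    ∃ lam : (Fin d₀ → Fin E₀) × (Fin d₁ → Fin E₁), s = expnt lam := by
  classical
  by_contra hne
  push Not at hne
  have : (auxP p).coeff s = 0 := by
    rw [auxP, coeff_sum]
    refine Finset.sum_eq_zero fun lam _ => ?_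
    rw [coeff_smul, coeff_monomial, if_neg (fun h => hne lam h.symm), smul_zero]
  exact (mem_support_iff.1 hs) this

/-- `P_p ≠ 0` when `p ≠ 0`. [folklore] -/
theorem auxP_ne_zero {p : (Fin d₀ → Fin E₀) × (Fin d₁ → Fin E₁) → ℤ} (hp : p ≠ 0) : auxP p ≠ 0 := by
  obtain ⟨lam, hlam⟩ : ∃ lam, p lam ≠ 0 := by
    by_contra h
    push Not at h
    exact hp (funext h)
  intro h0
  have := coeff_auxP_expnt p lam
  rw [h0, coeff_zero] at this
  exact hlam (by exact_mod_cast this.symm)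

/-- `deg_X P_p ≤ d₀ (E₀ − 1)`. [folklore] -/
theorem degX_auxP_le (p : (Fin d₀ → Fin E₀) × (Fin d₁ → Fin E₁) → ℤ) :
    degX (auxP p) ≤ d₀ * (E₀ - 1) := by
  rw [degX_le_iff]
  intro s hs
  obtain ⟨lam, rfl⟩ := exists_of_mem_support_auxP hs
  calc ∑ i, expnt lam (Sum.inl i) ≤ ∑ _i : Fin d₀, (E₀ - 1) :=
        Finset.sum_le_sum fun i _ => by rw [expnt_inl]; have := (lam.1 i).2; omega
    _ = d₀ * (E₀ - 1) := by simp

/-- `deg_Y P_p ≤ d₁ (E₁ − 1)`. [folklore] -/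
theorem degY_auxP_le (p : (Fin d₀ → Fin E₀) × (Fin d₁ → Fin E₁) → ℤ) :
    degY (auxP p) ≤ d₁ * (E₁ - 1) := by
  rw [degY_le_iff]
  intro s hs
  obtain ⟨lam, rfl⟩ := exists_of_mem_support_auxP hs
  calc ∑ l, expnt lam (Sum.inr l) ≤ ∑ _l : Fin d₁, (E₁ - 1) :=
        Finset.sum_le_sum fun l _ => by rw [expnt_inr]; have := (lam.2 l).2; omega
    _ = d₁ * (E₁ - 1) := by simp

/-- The line jets of `P_p`: `(D_x^k P_p)(g) = ∑_λ p_λ val_k(expnt λ)`. [folklore] -/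
theorem evalAt_iterate_auxP (p : (Fin d₀ → Fin E₀) × (Fin d₁ → Fin E₁) → ℤ)
    (x : (Fin d₀ → ℂ) × (Fin d₁ → ℂ)) (g : LinGroup d₀ d₁) (k : ℕ) :
    evalAt ((invDeriv x)^[k] (auxP p)) g = ∑ lam, (p lam : ℂ) * jetVal x g k (expnt lam) := by
  rw [auxP, invDeriv_iterate_sum, evalAt, map_sum]
  refine Finset.sum_congr rfl fun lam _ => ?_
  rw [invDeriv_iterate_smul, smul_eval]
  rfl

end AuxP

/-! ### Integrality of the line jets of `P_p` -/

section ArithP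

variable {ι : Type*} {a : ι → ℂ} {E₀ E₁ : ℕ}

/-- **Line jets of `P_p` are integer-polynomial values.** Under the hypotheses of
`intPolyBound_jetVal` and `|p_λ| ≤ P_b`:
`(D_x^k P_p)(g)` is `IntPolyBound a _ (d₀(E₀−1) e_y + d₁(E₁−1) e_Y + k) (#Λ P_b (L_x (A+B))^k L_y^A L_Y^B)`,
`A = d₀(E₀−1)`, `B = d₁(E₁−1)`. [folklore] -/
theorem intPolyBound_evalAt_iterate_auxP {x : (Fin d₀ → ℂ) × (Fin d₁ → ℂ)} {g : LinGroup d₀ d₁}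
    {e_y e_Y : ℕ} {L_y L_Y L_x : ℝ} (hL_y : 1 ≤ L_y) (hL_Y : 1 ≤ L_Y) (hL_x : 1 ≤ L_x)
    (hg₀ : ∀ i, IntPolyBound a (coord g (Sum.inl i)) e_y L_y)
    (hg₁ : ∀ l, IntPolyBound a (coord g (Sum.inr l)) e_Y L_Y)
    (hx₀ : ∀ i, IntPolyBound a (x.1 i) 1 L_x) (hx₁ : ∀ l, IntPolyBound a (x.2 l) 1 L_x)
    (p : (Fin d₀ → Fin E₀) × (Fin d₁ → Fin E₁) → ℤ) {Pb : ℕ} (hp : ∀ lam, |p lam| ≤ Pb) (k : ℕ) :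
    IntPolyBound a (evalAt ((invDeriv x)^[k] (auxP p)) g)
      (d₀ * (E₀ - 1) * e_y + d₁ * (E₁ - 1) * e_Y + k)
      (Fintype.card ((Fin d₀ → Fin E₀) × (Fin d₁ → Fin E₁)) * Pb *
        ((L_x * ((d₀ * (E₀ - 1) : ℕ) + (d₁ * (E₁ - 1) : ℕ))) ^ k *
          (L_y ^ (d₀ * (E₀ - 1)) * L_Y ^ (d₁ * (E₁ - 1))))) := by
  rw [evalAt_iterate_auxP]
  set K : ℝ := (L_x * ((d₀ * (E₀ - 1) : ℕ) + (d₁ * (E₁ - 1) : ℕ))) ^ k *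
    (L_y ^ (d₀ * (E₀ - 1)) * L_Y ^ (d₁ * (E₁ - 1))) with hK
  have hK0 : 0 ≤ K := by positivity
  have h := IntPolyBound.sum (a := a) Finset.univ
    (x := fun lam => (p lam : ℂ) * jetVal x g k (expnt lam))
    (e := d₀ * (E₀ - 1) * e_y + d₁ * (E₁ - 1) * e_Y + k) (L := fun _ => (Pb : ℝ) * K) fun lam _ => ?_
  · refine h.mono le_rfl (le_of_eq ?_)
    rw [Finset.sum_const, Finset.card_univ, nsmul_eq_mul]
    ring
  · have hA : ∑ i, expnt lam (Sum.inl i) ≤ d₀ * (E₀ - 1) := by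
      calc ∑ i, expnt lam (Sum.inl i) ≤ ∑ _i : Fin d₀, (E₀ - 1) :=
            Finset.sum_le_sum fun i _ => by rw [expnt_inl]; have := (lam.1 i).2; omega
        _ = d₀ * (E₀ - 1) := by simp
    have hB : ∑ l, expnt lam (Sum.inr l) ≤ d₁ * (E₁ - 1) := by
      calc ∑ l, expnt lam (Sum.inr l) ≤ ∑ _l : Fin d₁, (E₁ - 1) :=
            Finset.sum_le_sum fun l _ => by rw [expnt_inr]; have := (lam.2 l).2; omega
        _ = d₁ * (E₁ - 1) := by simp
    have hv := intPolyBound_jetVal hL_y hL_Y hL_x hg₀ hg₁ hx₀ hx₁ _ _ k (expnt lam) hA hB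
    have hv' : IntPolyBound a (jetVal x g k (expnt lam)) (d₀ * (E₀ - 1) * e_y + d₁ * (E₁ - 1) * e_Y + k) K := by
      rw [hK]
      push_cast at hv ⊢
      exact hv
    have hmul := (IntPolyBound.intCast (a := a) (p lam)).mul hv'
    rw [zero_add] at hmul
    refine hmul.mono le_rfl (mul_le_mul_of_nonneg_right ?_ hK0)
    exact_mod_cast hp lam

end ArithP

/-! ### Polarization for the jets of `w ↦ P(g · exp_G w)` -/

/-- **Mixed jets from line jets, algebraically**: for every `P`, point `g · exp_G v` and letters
`u₀, …, u_{k−1}`,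
`k! · (wordDeriv u P)(g exp_G v) = ∑_{S ⊆ [k]} (−1)^{|Sᶜ|} (D_{x_S}^k P)(g exp_G v)`,
`x_S = ∑_{i∈S} uᵢ` (the polarization identity for `D^k f(v)`, `f(w) = P(g exp_G w)`, read through
`iteratedFDeriv_evalAt_mul_exp_apply` and `iteratedDeriv_evalAt_mul_exp_line`). [folklore] -/
theorem factorial_smul_evalAt_wordDeriv (P : MvPolynomial (Fin d₀ ⊕ Fin d₁) ℂ) (g : LinGroup d₀ d₁)
    (v : (Fin d₀ → ℂ) × (Fin d₁ → ℂ)) {k : ℕ} (u : Fin k → (Fin d₀ → ℂ) × (Fin d₁ → ℂ)) :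
    (k.factorial : ℂ) * evalAt (wordDeriv u P) (g * exp v) =
      ∑ S : Finset (Fin k), (-1 : ℂ) ^ (Sᶜ).card *
        evalAt ((invDeriv (∑ i ∈ S, u i))^[k] P) (g * exp v) := by
  classical
  set f : (Fin d₀ → ℂ) × (Fin d₁ → ℂ) → ℂ := fun w => evalAt P (g * exp w) with hf
  have hfω : ContDiff ℂ ω f := contDiff_evalAt_mul_exp P g
  set M := (iteratedFDeriv ℂ k f v).toMultilinearMap with hM
  have hsymm : ∀ (σ : Equiv.Perm (Fin k)) (u' : Fin k → (Fin d₀ → ℂ) × (Fin d₁ → ℂ)),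
      M (fun j => u' (σ j)) = M u' := fun σ u' => hfω.contDiffAt.iteratedFDeriv_comp_perm u' σ
  have hpol := MultilinearMap.polarization M u
  have hR : ∑ σ : Equiv.Perm (Fin k), M (fun j => u (σ j)) = (k.factorial : ℂ) • M u := by
    rw [Finset.sum_congr rfl fun σ _ => hsymm σ u, Finset.sum_const, Finset.card_univ,
      Fintype.card_perm, Fintype.card_fin, ← Nat.cast_smul_eq_nsmul ℂ]
  have hMu : M u = evalAt (wordDeriv u P) (g * exp v) := by
    rw [hM, ContinuousMultilinearMap.coe_coe]
    exact iteratedFDeriv_evalAt_mul_exp_apply k P g v u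
  have hdiag : ∀ S : Finset (Fin k), M (fun _ => ∑ i ∈ S, u i) =
      evalAt ((invDeriv (∑ i ∈ S, u i))^[k] P) (g * exp v) := by
    intro S
    rw [hM, ContinuousMultilinearMap.coe_coe,
      ← iteratedDeriv_line_eq_iteratedFDeriv hfω v _ (le_top : (k : WithTop ℕ∞) ≤ ω)]
    exact iteratedDeriv_evalAt_mul_exp_line P g v _ k
  rw [hR, hMu, smul_eq_mul] at hpol
  rw [← hpol]
  exact Finset.sum_congr rfl fun S _ => by rw [hdiag, smul_eq_mul]

/-! ### Integrality of `k! · (mixed jet)` for letters from a family with integral coordinates -/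

section ArithWord

variable {ι : Type*} {a : ι → ℂ} {E₀ E₁ : ℕ}

/-- **`k! · (D_{w_{κ₀}} ⋯ D_{w_{κ_{k−1}}} P_p)(g exp_G v)` is an integer-polynomial value.** Here the
letters run through a family `w_j` whose coordinates are `IntPolyBound a _ 1 L_w` (e.g. a basis of
`W` with algebraic coordinates taken among the generators), the coordinates of the point
`g exp_G v` satisfy the hypotheses of `intPolyBound_jetVal`, and `|p_λ| ≤ P_b`. Bounds:
degree `A e_y + B e_Y + k` and length `2^k #Λ P_b (max(1, k L_w)(A+B))^k L_y^A L_Y^B`,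
`A = d₀(E₀−1)`, `B = d₁(E₁−1)`. [folklore] -/
theorem intPolyBound_factorial_mul_wordDeriv_auxP {J : Type*} (w : J → (Fin d₀ → ℂ) × (Fin d₁ → ℂ))
    {L_w : ℝ} (hL_w : 0 ≤ L_w) (hw₀ : ∀ j i, IntPolyBound a ((w j).1 i) 1 L_w)
    (hw₁ : ∀ j l, IntPolyBound a ((w j).2 l) 1 L_w)
    {g : LinGroup d₀ d₁} {v : (Fin d₀ → ℂ) × (Fin d₁ → ℂ)}
    {e_y e_Y : ℕ} {L_y L_Y : ℝ} (hL_y : 1 ≤ L_y) (hL_Y : 1 ≤ L_Y)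
    (hg₀ : ∀ i, IntPolyBound a (coord (g * exp v) (Sum.inl i)) e_y L_y)
    (hg₁ : ∀ l, IntPolyBound a (coord (g * exp v) (Sum.inr l)) e_Y L_Y)
    (p : (Fin d₀ → Fin E₀) × (Fin d₁ → Fin E₁) → ℤ) {Pb : ℕ} (hp : ∀ lam, |p lam| ≤ Pb)
    {k : ℕ} (κ : Fin k → J) :
    IntPolyBound a ((k.factorial : ℂ) * evalAt (wordDeriv (fun i => w (κ i)) (auxP p)) (g * exp v))
      (d₀ * (E₀ - 1) * e_y + d₁ * (E₁ - 1) * e_Y + k)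
      (2 ^ k * (Fintype.card ((Fin d₀ → Fin E₀) × (Fin d₁ → Fin E₁)) * Pb *
        ((max 1 (k * L_w) * ((d₀ * (E₀ - 1) : ℕ) + (d₁ * (E₁ - 1) : ℕ))) ^ k *
          (L_y ^ (d₀ * (E₀ - 1)) * L_Y ^ (d₁ * (E₁ - 1)))))) := by
  classical
  rw [factorial_smul_evalAt_wordDeriv]
  set L_x : ℝ := max 1 (k * L_w) with hL_x
  have hL_x1 : 1 ≤ L_x := le_max_left _ _
  set K : ℝ := Fintype.card ((Fin d₀ → Fin E₀) × (Fin d₁ → Fin E₁)) * Pb *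
    ((L_x * ((d₀ * (E₀ - 1) : ℕ) + (d₁ * (E₁ - 1) : ℕ))) ^ k *
      (L_y ^ (d₀ * (E₀ - 1)) * L_Y ^ (d₁ * (E₁ - 1)))) with hK
  have hK0 : 0 ≤ K := by positivity
  -- each term
  have hterm : ∀ S : Finset (Fin k), IntPolyBound a ((-1 : ℂ) ^ (Sᶜ).card *
      evalAt ((invDeriv (∑ i ∈ S, w (κ i)))^[k] (auxP p)) (g * exp v))
      (d₀ * (E₀ - 1) * e_y + d₁ * (E₁ - 1) * e_Y + k) K := by
    intro S
    -- coordinates of `x_S = ∑_{i∈S} w_{κ i}`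
    have hx₀ : ∀ i', IntPolyBound a ((∑ i ∈ S, w (κ i)).1 i') 1 L_x := by
      intro i'
      rw [Prod.fst_sum, Finset.sum_apply]
      have h := IntPolyBound.sum (a := a) S (x := fun i => (w (κ i)).1 i') (e := 1)
        (L := fun _ => L_w) fun i _ => hw₀ (κ i) i'
      refine h.mono le_rfl ?_
      rw [Finset.sum_const, nsmul_eq_mul]
      calc (S.card : ℝ) * L_w ≤ k * L_w := by
            refine mul_le_mul_of_nonneg_right ?_ hL_w
            exact_mod_cast (Finset.card_le_univ S).trans_eq (Fintype.card_fin k)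
        _ ≤ L_x := le_max_right _ _
    have hx₁ : ∀ l, IntPolyBound a ((∑ i ∈ S, w (κ i)).2 l) 1 L_x := by
      intro l
      rw [Prod.snd_sum, Finset.sum_apply]
      have h := IntPolyBound.sum (a := a) S (x := fun i => (w (κ i)).2 l) (e := 1)
        (L := fun _ => L_w) fun i _ => hw₁ (κ i) l
      refine h.mono le_rfl ?_
      rw [Finset.sum_const, nsmul_eq_mul]
      calc (S.card : ℝ) * L_w ≤ k * L_w := by
            refine mul_le_mul_of_nonneg_right ?_ hL_w
            exact_mod_cast (Finset.card_le_univ S).trans_eq (Fintype.card_fin k)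
        _ ≤ L_x := le_max_right _ _
    have hjet := intPolyBound_evalAt_iterate_auxP hL_y hL_Y hL_x1 hg₀ hg₁ hx₀ hx₁ p hp k
    have hsign : IntPolyBound a ((-1 : ℂ) ^ (Sᶜ).card) 0 1 := by
      have h := (IntPolyBound.intCast (a := a) (-1)).pow (Sᶜ).card
      simp only [mul_zero, Int.cast_neg, Int.cast_one, abs_neg, abs_one, one_pow] at h
      exact h
    have := hsign.mul hjet
    rw [zero_add, one_mul] at this
    exact this
  have hsum := IntPolyBound.sum (a := a) Finset.univ
    (x := fun S : Finset (Fin k) => (-1 : ℂ) ^ (Sᶜ).card *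
      evalAt ((invDeriv (∑ i ∈ S, w (κ i)))^[k] (auxP p)) (g * exp v))
    (e := d₀ * (E₀ - 1) * e_y + d₁ * (E₁ - 1) * e_Y + k) (L := fun _ => K) fun S _ => hterm S
  refine hsum.mono le_rfl (le_of_eq ?_)
  rw [Finset.sum_const, Finset.card_univ, Fintype.card_finset, Fintype.card_fin, nsmul_eq_mul, hK]
  push_cast
  ring

end ArithWord

/-! ### Words with letters from a spanning family suffice -/

/-- **Words on a spanning family suffice**: `P` vanishes to order `≥ N` at `g` along `exp_G(W)` as
soon as `(D_{w_{κ₀}} ⋯ D_{w_{κ_{k−1}}} P)(g) = 0` for all `k < N` and all words with letters from a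
family `w` spanning `W` (the mixed jet is multilinear in the letters: expand each letter on `w`).
[folklore] -/
theorem vanishesToOrder_of_span_words (P : MvPolynomial (Fin d₀ ⊕ Fin d₁) ℂ)
    (W : Submodule ℂ ((Fin d₀ → ℂ) × (Fin d₁ → ℂ))) (g : LinGroup d₀ d₁) (N : ℕ)
    {J : Type*} [Fintype J] (w : J → (Fin d₀ → ℂ) × (Fin d₁ → ℂ))
    (hspan : W ≤ Submodule.span ℂ (Set.range w))
    (h : ∀ k < N, ∀ κ : Fin k → J, evalAt (wordDeriv (fun i => w (κ i)) P) g = 0) :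
    VanishesToOrder P W g N := by
  classical
  rw [vanishesToOrder_iff_wordDeriv]
  intro k hk u hu
  set M := iteratedFDeriv ℂ k (fun w' : (Fin d₀ → ℂ) × (Fin d₁ → ℂ) => evalAt P (g * exp w')) 0
    with hM
  have hMu : ∀ u' : Fin k → (Fin d₀ → ℂ) × (Fin d₁ → ℂ), M u' = evalAt (wordDeriv u' P) g := by
    intro u'
    have := iteratedFDeriv_evalAt_mul_exp_apply k P g 0 u'
    rwa [exp_zero, mul_one] at this
  choose c hc using fun i =>
    (Submodule.mem_span_range_iff_exists_fun ℂ).1 (hspan (hu i))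
  have hu' : u = fun i => ∑ j ∈ Finset.univ, c i j • w j := funext fun i => (hc i).symm
  have e1 := M.toMultilinearMap.map_sum_finset (fun i j => c i j • w j) (fun _ => Finset.univ)
  simp only [ContinuousMultilinearMap.coe_coe] at e1
  rw [← hMu, hu', e1]
  refine Finset.sum_eq_zero fun r _ => ?_
  have e2 := M.toMultilinearMap.map_smul_univ (fun i => c i (r i)) (fun i => w (r i))
  simp only [ContinuousMultilinearMap.coe_coe] at e2
  rw [e2, hMu, h k hk r, smul_zero]

end LinGroup

end Literature.NumberTheory.Transcendental
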